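import Mathlib
import HarnessLib
import Summits.AtomisticToContinuum.Crystallization.Theorems.PricedLinkCensusSoftLayerPropagationStubBallPropagationStacking
import Summits.AtomisticToContinuum.Crystallization.Theorems.PricedLinkCensusSoftLayerPropagationStubBallPropagationAssembly
import Summits.AtomisticToContinuum.Crystallization.Theorems.BrittleRungDescentSoftLayerPropagationCovering

/-!
# Local layer propagation, HCP case: certified stacking points and the walk

Route `BrittleRungDescent`, support item `SoftLayerPropagation` (stmt-AtomisticToContinuum-9210),
helper file (η = 0; vocabulary of `PricedLinkCensus…Stacking.lean` / `…Assembly.lean` and the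
covering lemma of `…SoftLayerPropagationCovering.lean`).

* `layers_shell` — the certified discs of the layer reconstruction, read on the Barlow stacking of
  the spliced Hägg sequence: every stacking point of layer `n` (resp. `−n`) whose horizontal foot is
  within the disc radius is a centre **whose shell in `V` is its shell in the stacking**
  (the shell version of `barlowPos_mem_of_layers`, without rings).
* `walk` — **from certified stacking points near `u′` to the whole `R`-ball.**  If every stacking
  point within `ν` of `u′` (`ν ≥ R − 1`, `ν ≥ 3.2`) is a centre of `V` with its stacking shell,
  and every centre within `R` of `u′` has an FCC/HCP shell, then every centre within `R` of `u′`
  is a stacking point: walk towards `u′` through closer neighbours (the covering lemma) until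
  within `1.6` of `u′`, where the nearest stacking point (within `√22/3`) is a centre, hence the
  point itself; climbing back, each step stays in the stacking by the certified shells.

All statements are elementary ([folklore]).
-/

noncomputable section

namespace Summit.AtomisticToContinuum.Crystallization.Theorems

open Literature.Geometry.DiscreteGeometry Literature.MathematicalPhysics.StatisticalMechanics
open RealInnerProductSpace

/-- **Certified stacking points of the layer reconstruction.**  With the base disc
(`layerShell σ₀ σ₀′` shells), the layers above (`layers_up`) and below (`layers_down`) and the
spliced Hägg sequence `s` (`exists_haggSeq_of_signs`), every stacking point `barlowPos 2 𝗁 s n i j`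
(`0 ≤ n ≤ N⁺`, resp. `−N⁻ ≤ −n ≤ −1`) with horizontal foot within `ρ n` of `c` is a centre of `V`
whose shell in `V` equals its shell in `barlowStacking 2 𝗁 s`. [folklore] -/
theorem layers_shell {V : Set (EuclideanSpace ℝ (Fin 3))} {c : EuclideanSpace ℝ (Fin 3)}
    (Np Nm : ℕ) (ρp ρm : ℕ → ℝ) {σ₀ σ₀' : ℝ} {s : ℤ → ℤ} (hs : IsHaggSeq s) (sp sm : ℕ → ℝ)
    (hLp : ∀ n : ℕ, ((haggLabel s n : ℤ) : ℝ) = ∑ m ∈ Finset.range n, sp m)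
    (hLm : ∀ n : ℕ, ((haggLabel s (-(n : ℤ)) : ℤ) : ℝ) = ∑ m ∈ Finset.range n, sm m)
    (hsp : ∀ n : ℕ, ((s n : ℤ) : ℝ) = sp n) (hsm : ∀ n : ℕ, ((s (-((n : ℤ) + 1)) : ℤ) : ℝ) = -sm n)
    (hsp0 : sp 0 = σ₀) (hsm0 : sm 0 = σ₀')
    (hbase : ∀ i j : ℤ,
      ‖((i : ℝ) • (triangularVec₁ 2 : EuclideanSpace ℝ (Fin 3)) + (j : ℝ) • triangularVec₂ 2) - c‖ ≤ ρp 0 →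
      (i : ℝ) • (triangularVec₁ 2 : EuclideanSpace ℝ (Fin 3)) + (j : ℝ) • triangularVec₂ 2 ∈ V ∧
      kissingShell V ((i : ℝ) • (triangularVec₁ 2 : EuclideanSpace ℝ (Fin 3)) + (j : ℝ) • triangularVec₂ 2)
        = layerShell σ₀ σ₀')
    (hup : ∀ n < Np, ∀ i j : ℤ,
        ‖((i : ℝ) • (triangularVec₁ 2 : EuclideanSpace ℝ (Fin 3)) + (j : ℝ) • triangularVec₂ 2 +
            (∑ m ∈ Finset.range (n + 1), sp m) • barlowOffset 2) - c‖ ≤ ρp (n + 1) →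
        (i : ℝ) • (triangularVec₁ 2 : EuclideanSpace ℝ (Fin 3)) + (j : ℝ) • triangularVec₂ 2 +
            (∑ m ∈ Finset.range (n + 1), sp m) • barlowOffset 2 +
            ((n : ℝ) + 1) • layerNormal layerSpacing ∈ V ∧
        kissingShell V ((i : ℝ) • (triangularVec₁ 2 : EuclideanSpace ℝ (Fin 3)) + (j : ℝ) • triangularVec₂ 2 +
            (∑ m ∈ Finset.range (n + 1), sp m) • barlowOffset 2 +
            ((n : ℝ) + 1) • layerNormal layerSpacing) = layerShell (sp (n + 1)) (-(sp n)))
    (hdown : ∀ n < Nm, ∀ i j : ℤ,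
        ‖((i : ℝ) • (triangularVec₁ 2 : EuclideanSpace ℝ (Fin 3)) + (j : ℝ) • triangularVec₂ 2 +
            (∑ m ∈ Finset.range (n + 1), sm m) • barlowOffset 2) - c‖ ≤ ρm (n + 1) →
        (i : ℝ) • (triangularVec₁ 2 : EuclideanSpace ℝ (Fin 3)) + (j : ℝ) • triangularVec₂ 2 +
            (∑ m ∈ Finset.range (n + 1), sm m) • barlowOffset 2 -
            ((n : ℝ) + 1) • layerNormal layerSpacing ∈ V ∧
        kissingShell V ((i : ℝ) • (triangularVec₁ 2 : EuclideanSpace ℝ (Fin 3)) + (j : ℝ) • triangularVec₂ 2 +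
            (∑ m ∈ Finset.range (n + 1), sm m) • barlowOffset 2 -
            ((n : ℝ) + 1) • layerNormal layerSpacing) = layerShell (-(sm n)) (sm (n + 1))) :
    (∀ n : ℕ, n ≤ Np → ∀ i j : ℤ,
      ‖((i : ℝ) • (triangularVec₁ 2 : EuclideanSpace ℝ (Fin 3)) + (j : ℝ) • triangularVec₂ 2 +
          ((haggLabel s n : ℤ) : ℝ) • barlowOffset 2) - c‖ ≤ ρp n →
      barlowPos 2 layerSpacing s n i j ∈ V ∧
        kissingShell V (barlowPos 2 layerSpacing s n i j) =
          kissingShell (barlowStacking 2 layerSpacing s) (barlowPos 2 layerSpacing s n i j)) ∧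
    (∀ n : ℕ, 1 ≤ n → n ≤ Nm → ∀ i j : ℤ,
      ‖((i : ℝ) • (triangularVec₁ 2 : EuclideanSpace ℝ (Fin 3)) + (j : ℝ) • triangularVec₂ 2 +
          ((haggLabel s (-(n : ℤ)) : ℤ) : ℝ) • barlowOffset 2) - c‖ ≤ ρm n →
      barlowPos 2 layerSpacing s (-(n : ℤ)) i j ∈ V ∧
        kissingShell V (barlowPos 2 layerSpacing s (-(n : ℤ)) i j) =
          kissingShell (barlowStacking 2 layerSpacing s) (barlowPos 2 layerSpacing s (-(n : ℤ)) i j)) := by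
  set Lat : ℤ → ℤ → EuclideanSpace ℝ (Fin 3) := fun i j =>
    (i : ℝ) • (triangularVec₁ 2 : EuclideanSpace ℝ (Fin 3)) + (j : ℝ) • triangularVec₂ 2 with hLat
  refine ⟨fun n hn i j hij => ?_, fun n hn1 hn i j hij => ?_⟩
  · rw [kissingShell_barlowStacking_eq_layerShell hs]
    rcases Nat.eq_zero_or_pos n with rfl | hpos
    · have e1 : barlowPos 2 layerSpacing s ((0 : ℕ) : ℤ) i j = Lat i j := by
        simp [barlowPos, hLat]
      have hL0 : ((haggLabel s ((0 : ℕ) : ℤ) : ℤ) : ℝ) = 0 := by rw [hLp 0]; simp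
      rw [hL0, zero_smul, add_zero] at hij
      obtain ⟨hmem, hsh⟩ := hbase i j hij
      refine ⟨by rw [e1]; exact hmem, ?_⟩
      rw [e1, hsh]
      have h0 : ((s ((0 : ℕ) : ℤ) : ℤ) : ℝ) = σ₀ := by rw [← hsp0]; exact_mod_cast hsp 0
      have h1 : ((s (((0 : ℕ) : ℤ) - 1) : ℤ) : ℝ) = -σ₀' := by
        rw [← hsm0]; exact_mod_cast hsm 0
      rw [h0, h1, neg_neg]
    · obtain ⟨m, rfl⟩ : ∃ m, n = m + 1 := ⟨n - 1, by omega⟩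
      have hm : m < Np := Nat.lt_of_succ_le hn
      have hL' : ((haggLabel s ((m + 1 : ℕ) : ℤ) : ℤ) : ℝ) = ∑ k ∈ Finset.range (m + 1), sp k :=
        hLp (m + 1)
      have e1 : barlowPos 2 layerSpacing s ((m + 1 : ℕ) : ℤ) i j =
          Lat i j + (∑ k ∈ Finset.range (m + 1), sp k) • barlowOffset 2 +
            ((m : ℝ) + 1) • layerNormal layerSpacing := by
        simp only [barlowPos, hLat]
        rw [hL']; push_cast; module
      rw [hL'] at hij
      obtain ⟨hmem, hsh⟩ := hup m hm i j hij
      refine ⟨by rw [e1]; exact hmem, ?_⟩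
      rw [e1, hsh]
      have h0 : ((s ((m + 1 : ℕ) : ℤ) : ℤ) : ℝ) = sp (m + 1) := by exact_mod_cast hsp (m + 1)
      have h1 : ((s (((m + 1 : ℕ) : ℤ) - 1) : ℤ) : ℝ) = sp m := by
        have : ((m + 1 : ℕ) : ℤ) - 1 = ((m : ℕ) : ℤ) := by push_cast; ring
        rw [this]; exact_mod_cast hsp m
      rw [h0, h1]
  · rw [kissingShell_barlowStacking_eq_layerShell hs]
    obtain ⟨m, rfl⟩ : ∃ m, n = m + 1 := ⟨n - 1, by omega⟩
    have hm : m < Nm := Nat.lt_of_succ_le hn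
    have hL' : ((haggLabel s (-((m + 1 : ℕ) : ℤ)) : ℤ) : ℝ) = ∑ k ∈ Finset.range (m + 1), sm k :=
      hLm (m + 1)
    have e1 : barlowPos 2 layerSpacing s (-((m + 1 : ℕ) : ℤ)) i j =
        Lat i j + (∑ k ∈ Finset.range (m + 1), sm k) • barlowOffset 2 -
          ((m : ℝ) + 1) • layerNormal layerSpacing := by
      simp only [barlowPos, hLat]
      rw [hL']; push_cast; module
    rw [hL'] at hij
    obtain ⟨hmem, hsh⟩ := hdown m hm i j hij
    refine ⟨by rw [e1]; exact hmem, ?_⟩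
    rw [e1, hsh]
    have h0 : ((s (-((m + 1 : ℕ) : ℤ)) : ℤ) : ℝ) = -sm m := by exact_mod_cast hsm m
    have h1 : ((s (-((m + 1 : ℕ) : ℤ) - 1) : ℤ) : ℝ) = -sm (m + 1) := by
      have : -((m + 1 : ℕ) : ℤ) - 1 = -(((m + 1 : ℕ) : ℤ) + 1) := by ring
      rw [this]; exact_mod_cast hsm (m + 1)
    rw [h0, h1, neg_neg]

/-- `√22/3 + 1.6 ≤ 3.2`. [folklore] -/
theorem sqrt_twentytwo_div_three_add_le : Real.sqrt 22 / 3 + 1.6 ≤ 3.2 := by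
  have : Real.sqrt 22 ≤ 4.8 := by
    rw [Real.sqrt_le_left (by norm_num)]; norm_num
  linarith

/-- **The walk.**  Let `V` be a packing of unit balls, `s` a Hägg sequence, `R ≥ 4`,
`ν ≥ max (R − 1, 3.2)`; suppose every stacking point of `barlowStacking 2 𝗁 s` within `ν` of `u′`
is a centre of `V` whose shell in `V` is its stacking shell, and every centre within `R` of `u′`
has an FCC or HCP shell.  Then every centre within `R` of `u′` is a stacking point. [folklore] -/
theorem walk {V : Set (EuclideanSpace ℝ (Fin 3))} (hV : IsUnitBallPacking V) {s : ℤ → ℤ}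
    {u' : EuclideanSpace ℝ (Fin 3)} {R ν : ℝ} (hR : 4 ≤ R) (hν : R - 1 ≤ ν) (hν3 : 3.2 ≤ ν)
    (hpat : ∀ x ∈ V, dist x u' ≤ R →
      IsArrangedIn (kissingShell V x) fccKissingPattern ∨ IsArrangedIn (kissingShell V x) hcpKissingPattern)
    (hcert : ∀ k i j : ℤ, dist (barlowPos 2 layerSpacing s k i j) u' ≤ ν →
      barlowPos 2 layerSpacing s k i j ∈ V ∧
        kissingShell V (barlowPos 2 layerSpacing s k i j) =
          kissingShell (barlowStacking 2 layerSpacing s) (barlowPos 2 layerSpacing s k i j)) :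
    ∀ x ∈ V, dist x u' ≤ R → x ∈ barlowStacking 2 layerSpacing s := by
  -- the base of the walk: within `1.6` of `u'`, the nearest stacking point is a centre
  have base : ∀ x ∈ V, dist x u' < 1.6 → x ∈ barlowStacking 2 layerSpacing s := by
    intro x hx hnear
    obtain ⟨k, i, j, hz⟩ := exists_dist_barlowPos_le s x
    have hzu : dist (barlowPos 2 layerSpacing s k i j) u' ≤ ν := by
      have := dist_triangle (barlowPos 2 layerSpacing s k i j) x u'
      rw [dist_comm] at hz
      linarith [sqrt_twentytwo_div_three_add_le]
    have hzV := (hcert k i j hzu).1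
    have hlt : dist x (barlowPos 2 layerSpacing s k i j) < 2 := by
      have : Real.sqrt 22 / 3 < 2 := by linarith [sqrt_twentytwo_div_three_add_le]
      linarith
    rw [hV hx hzV hlt]
    exact barlowPos_mem _ _ _
  -- induction on `⌈2 · dist²⌉`
  suffices H : ∀ n : ℕ, ∀ x ∈ V, dist x u' ≤ R → 2 * dist x u' ^ 2 ≤ n →
      x ∈ barlowStacking 2 layerSpacing s by
    intro x hx hxR
    exact H ⌈2 * dist x u' ^ 2⌉₊ x hx hxR (Nat.le_ceil _)
  intro n
  induction n with
  | zero =>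
    intro x hx hxR hn
    push_cast at hn
    refine base x hx ?_
    nlinarith [dist_nonneg (x := x) (y := u')]
  | succ n ih =>
    intro x hx hxR hn
    by_cases hnear : dist x u' < 1.6
    · exact base x hx hnear
    · -- a closer neighbour
      have hnear : (1.6 : ℝ) ≤ dist x u' := not_lt.mp hnear
      obtain ⟨p, hp, hle⟩ := exists_mem_kissingShell_norm_add_sub_sq_le (hpat x hx hxR) u'
      have hp2 : ‖p‖ = 2 := hp.2
      have hx'V : x + p ∈ V := hp.1
      have hs2 : (1.4142 : ℝ) < Real.sqrt 2 := by
        rw [Real.lt_sqrt (by norm_num)]; norm_num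
      rw [← dist_eq_norm, ← dist_eq_norm] at hle
      have hd0 := dist_nonneg (x := x + p) (y := u')
      have hdec : dist (x + p) u' ^ 2 ≤ dist x u' ^ 2 - 0.525 := by nlinarith
      have hx'R : dist (x + p) u' ≤ R := by nlinarith [dist_nonneg (x := x) (y := u')]
      have hx'ν : dist (x + p) u' ≤ ν := by
        have h1 : dist (x + p) u' ^ 2 ≤ (R - 1) ^ 2 := by
          nlinarith [mul_nonneg (sub_nonneg.2 hxR) (sub_nonneg.2 hnear)]
        nlinarith
      have hx'P : x + p ∈ barlowStacking 2 layerSpacing s :=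
        ih (x + p) hx'V hx'R (by push_cast at hn ⊢; linarith)
      obtain ⟨k, i, j, hk⟩ := hx'P
      obtain ⟨-, hsh⟩ := hcert k i j (by rw [← hk]; exact hx'ν)
      have hneg : -p ∈ kissingShell V (x + p) := by
        refine ⟨?_, by rw [norm_neg, hp2]⟩
        rw [add_neg_cancel_right]; exact hx
      rw [hk, hsh] at hneg
      have := hneg.1
      rw [← hk, add_neg_cancel_right] at this
      exact this

end Summit.AtomisticToContinuum.Crystallization.Theorems
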